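import Mathlib
import Literature.NumberTheory.LFunctions.Zhang2022.Section17R1PrimeBulkInner
import HarnessLib

/-!
# Zhang (2022) §17.u021, remainder `R₁`, piece M2L-p BULK: the bulk at a fixed large `D` is at most
# `16Cα𝓛^{11/10}·[ (ν⁻ + perturbation)-sum + tail-sum ]` (blueprint Step C)

Topic `Literature/NumberTheory/LFunctions/Zhang2022` (Landau–Siegel audit tree; verdict-neutral).
Y. Zhang, *Discrete mean estimates and the Landau–Siegel zero*, arXiv:2211.02515v1 (2022)
[Zhang2022LandauSiegel] — **an unrefereed manuscript under adjudication**; nothing here asserts or denies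
its Theorems 1–2. §17 p. 98 (u021; no bound in print). Piece M2L-p BULK of the sub-leaf `R₁` (WP16 leaf
h17_9; blueprint `wp16/zl-w16-p3/R1-BULK-PLAN.md`). At a fixed `D` with `𝓛 ≥ 3`, `|c′α𝓛| ≤ 1/14`, a
real `χ` and the M1 majorant (constant `C ≥ 0`), the prime bulk

  `B(D) = Σ_{l<D⁴} |ν(l)|/l Σ_{l=q₁q₂} Σ'_{m₁}Σ'_p [D⁴<q₂p, p prime, p∤q₁, 4D⁴p ≤ T²] ‖b(q₁m₁)‖‖ν₁*(q₂p)‖‖κ̄₂(m₁p)‖/(m₁p)`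

satisfies `B(D) ≤ 16Cα𝓛^{11/10}·(Σ_MAIN + Σ_TAIL)` with, for `P₀` = the primes `p ≤ ⌊T²⌋` with
`4D⁴p ≤ T²` and `δ = 10α𝓛^{11/10} + ½e^{−𝓛³⁰}`,
`Σ_MAIN = Σ_{l<D⁴} |ν(l)|/l Σ_{l=q₁q₂} τ₂(q₁) Σ_{p∈P₀} (2‖ν⁻(q₂)‖ + 2δ·4τ₄(q₂))/p` (bounded by
`Section17R1PrimeBulkMain.bulk_main_pert_sum_le`) and
`Σ_TAIL = Σ_{l<D⁴} τ₂(l)/l Σ_{l=q₁q₂} τ₂(q₁) Σ_{p∈P₀} T(q₂,p)/p` (bounded by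
`Section17R1PrimeBulkTailSum.bulk_tail_sum_le` and then `Lemma32Flat.lemma_3_2_flat_long` under (A)).
Inputs: `inner_tsum_le` (Steps A–B) and `norm_nuOneStar_prime_arg_le` (pointwise). Theorems only;
axioms standard. The remaining assembly (thresholds, (A), numerics) is the next file.

## References

* Y. Zhang, arXiv:2211.02515v1 (2022), §17 p. 98 (u021). [cite: Zhang2022LandauSiegel, §17 u021 p.98]
-/

noncomputable section

open Complex Real Finset ArithmeticFunction
open Literature.NumberTheory.LFunctions.Zhang2022.Skeleton
open Literature.NumberTheory.LFunctions.Zhang2022.Typed.Section17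
open Literature.NumberTheory.LFunctions.Zhang2022.MeanSquareMajorant

namespace Literature.NumberTheory.LFunctions.Zhang2022.Phi3Eval

variable (c' : ℝ) {D : ℕ} (χ : DirichletCharacter ℂ D)

/-- **Blueprint Step C (the split at fixed `D`)**. [cite: Zhang2022LandauSiegel, §17 u021 p.98] -/
theorem bulk_le_main_add_tail (hq : χ.IsQuadratic) (hℓ : 3 ≤ ell D)
    (hc : |c' * alpha D * ell D| ≤ 1 / 14) {C : ℝ} (hC : 0 ≤ C)
    (hM1D : ∀ q₁ m₂ : ℕ, 1 ≤ q₁ → 1 ≤ m₂ →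
      (∑' m₁ : ℕ, ‖bcoef D (q₁ * m₁)‖ * ‖kappa2bar c' D (m₁ * m₂)‖ / (m₁ : ℝ)) ≤
        C * (q₁.divisors.card : ℝ) * ‖kappa2bar c' D m₂‖ * ((m₂ : ℝ) / m₂.totient) ^ 2) :
    ∑ l ∈ Finset.Ico 1 (D ^ 4), ‖nu χ l‖ / l *
        ∑ q ∈ l.divisorsAntidiagonal, ∑' m₁ : ℕ, ∑' p : ℕ,
          (if (D : ℝ) ^ 4 < q.2 * p ∧ p.Prime ∧ ¬ p ∣ q.1 ∧ 4 * (D : ℝ) ^ 4 * p ≤ bigT D ^ 2 then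
            ‖bcoef D (q.1 * m₁)‖ * ‖nuOneStar c' χ (q.2 * p)‖ * ‖kappa2bar c' D (m₁ * p)‖ /
              ((m₁ : ℝ) * p) else 0) ≤
      16 * C * alpha D * ell D ^ (11 / 10 : ℝ) *
        ((∑ l ∈ Finset.Ico 1 (D ^ 4), ‖nu χ l‖ / l * ∑ q ∈ l.divisorsAntidiagonal, tau 2 q.1 *
            ∑ p ∈ (Finset.range (⌊bigT D ^ 2⌋₊ + 1)).filter
              (fun p : ℕ => p.Prime ∧ 4 * (D : ℝ) ^ 4 * p ≤ bigT D ^ 2),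
              (2 * ‖∑ d ∈ q.2.divisors, (ArithmeticFunction.moebius d : ℂ) * χ (d : ZMod D)‖ +
                2 * (10 * alpha D * ell D ^ (11 / 10 : ℝ) + (1 / 2 : ℝ) * Real.exp (-(ell D ^ 30))) *
                  (4 * tau 4 q.2)) / p) +
          ∑ l ∈ Finset.Ico 1 (D ^ 4), tau 2 l / l * ∑ q ∈ l.divisorsAntidiagonal, tau 2 q.1 *
            ∑ p ∈ (Finset.range (⌊bigT D ^ 2⌋₊ + 1)).filter
              (fun p : ℕ => p.Prime ∧ 4 * (D : ℝ) ^ 4 * p ≤ bigT D ^ 2),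
              (∑ a ∈ q.2.divisors with D ^ 4 < p * a, ‖nu χ (p * a)‖ ^ 2 * tau 2 (q.2 / a)) / p) := by
  classical
  set δ : ℝ := 10 * alpha D * ell D ^ (11 / 10 : ℝ) + (1 / 2 : ℝ) * Real.exp (-(ell D ^ 30)) with hδ
  set P₀ := (Finset.range (⌊bigT D ^ 2⌋₊ + 1)).filter
    (fun p : ℕ => p.Prime ∧ 4 * (D : ℝ) ^ 4 * p ≤ bigT D ^ 2) with hP₀
  set K : ℝ := 16 * C * alpha D * ell D ^ (11 / 10 : ℝ) with hK
  have hℓ0 : 0 < ell D := by linarith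
  have hα0 : 0 < alpha D := alpha_pos' hℓ0
  have hK0 : 0 ≤ K := by rw [hK]; positivity
  have hδ0 : 0 ≤ δ := by rw [hδ]; positivity
  -- names for the pointwise pieces
  set N : ℕ → ℝ := fun q₂ => ‖∑ d ∈ q₂.divisors, (ArithmeticFunction.moebius d : ℂ) * χ (d : ZMod D)‖
    with hN
  set T : ℕ → ℕ → ℝ := fun q₂ p =>
    ∑ a ∈ q₂.divisors with D ^ 4 < p * a, ‖nu χ (p * a)‖ ^ 2 * tau 2 (q₂ / a) with hT
  have hN0 : ∀ q₂, 0 ≤ N q₂ := fun _ => norm_nonneg _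
  have hT0 : ∀ q₂ p, 0 ≤ T q₂ p := fun _ _ => Finset.sum_nonneg fun _ _ =>
    mul_nonneg (by positivity) (tau_nonneg _ _)
  -- termwise in `(l, q)`
  have hterm : ∀ l ∈ Finset.Ico 1 (D ^ 4), ∀ q ∈ l.divisorsAntidiagonal,
      (∑' m₁ : ℕ, ∑' p : ℕ,
        (if (D : ℝ) ^ 4 < q.2 * p ∧ p.Prime ∧ ¬ p ∣ q.1 ∧ 4 * (D : ℝ) ^ 4 * p ≤ bigT D ^ 2 then
          ‖bcoef D (q.1 * m₁)‖ * ‖nuOneStar c' χ (q.2 * p)‖ * ‖kappa2bar c' D (m₁ * p)‖ /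
            ((m₁ : ℝ) * p) else 0)) ≤
      K * (tau 2 q.1 * ∑ p ∈ P₀, (2 * N q.2 + 2 * δ * (4 * tau 4 q.2)) / p) +
        K * (tau 2 q.1 * ∑ p ∈ P₀, T q.2 p / p) := by
    intro l hl q hql
    have hl' := Finset.mem_Ico.1 hl
    obtain ⟨hq1, hq2, hq1l, hq2l⟩ := bounds_of_mem_antidiag hql
    have hq2D : q.2 ≤ D ^ 4 := hq2l.trans hl'.2.le
    have h1 := inner_tsum_le c' χ hℓ hc hC hM1D (Nat.one_le_iff_ne_zero.2 hq1) q.2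
    refine h1.trans ?_
    rw [← tau_two_apply, ← mul_add, show 16 * C * alpha D * ell D ^ (11 / 10 : ℝ) = K from rfl,
      mul_assoc]
    refine mul_le_mul_of_nonneg_left ?_ hK0
    rw [← mul_add, ← Finset.sum_add_distrib]
    refine mul_le_mul_of_nonneg_left ?_ (tau_nonneg _ _)
    -- compare the filtered `p`-sums: `S(q) ⊆ P₀`, pointwise bound on `S(q)`
    have hsub : (Finset.range (⌊bigT D ^ 2⌋₊ + 1)).filter (fun p : ℕ =>
        (D : ℝ) ^ 4 < q.2 * p ∧ p.Prime ∧ ¬ p ∣ q.1 ∧ 4 * (D : ℝ) ^ 4 * p ≤ bigT D ^ 2) ⊆ P₀ := by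
      intro p hp
      rw [Finset.mem_filter] at hp
      rw [hP₀, Finset.mem_filter]
      exact ⟨hp.1, hp.2.2.1, hp.2.2.2.2⟩
    have hpoint : ∀ p ∈ (Finset.range (⌊bigT D ^ 2⌋₊ + 1)).filter (fun p : ℕ =>
        (D : ℝ) ^ 4 < q.2 * p ∧ p.Prime ∧ ¬ p ∣ q.1 ∧ 4 * (D : ℝ) ^ 4 * p ≤ bigT D ^ 2),
        ‖nuOneStar c' χ (q.2 * p)‖ / p ≤ (2 * N q.2 + 2 * δ * (4 * tau 4 q.2)) / p + T q.2 p / p := by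
      intro p hp
      have hp' := (Finset.mem_filter.1 hp).2
      obtain ⟨_, hpr, _, h4⟩ := hp'
      have hp0 : (0 : ℝ) < p := by exact_mod_cast hpr.pos
      have hvT : 4 * ((q.2 * p : ℕ) : ℝ) ≤ bigT D ^ 2 := by
        have hq2D' : (q.2 : ℝ) ≤ (D : ℝ) ^ 4 := by exact_mod_cast hq2D
        push_cast
        nlinarith
      have hpt := norm_nuOneStar_prime_arg_le c' χ hq hℓ hc hq2 hq2D hpr hvT
      rw [← hδ] at hpt
      rw [← add_div]
      refine div_le_div_of_nonneg_right (hpt.trans (le_of_eq ?_)) hp0.le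
      simp only [hN, hT]
      ring
    calc ∑ p ∈ (Finset.range (⌊bigT D ^ 2⌋₊ + 1)).filter (fun p : ℕ =>
          (D : ℝ) ^ 4 < q.2 * p ∧ p.Prime ∧ ¬ p ∣ q.1 ∧ 4 * (D : ℝ) ^ 4 * p ≤ bigT D ^ 2),
          ‖nuOneStar c' χ (q.2 * p)‖ / p
        ≤ ∑ p ∈ (Finset.range (⌊bigT D ^ 2⌋₊ + 1)).filter (fun p : ℕ =>
            (D : ℝ) ^ 4 < q.2 * p ∧ p.Prime ∧ ¬ p ∣ q.1 ∧ 4 * (D : ℝ) ^ 4 * p ≤ bigT D ^ 2),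
            ((2 * N q.2 + 2 * δ * (4 * tau 4 q.2)) / p + T q.2 p / p) := Finset.sum_le_sum hpoint
      _ ≤ ∑ p ∈ P₀, ((2 * N q.2 + 2 * δ * (4 * tau 4 q.2)) / p + T q.2 p / p) :=
          Finset.sum_le_sum_of_subset_of_nonneg hsub fun p _ _ => add_nonneg
            (div_nonneg (add_nonneg (mul_nonneg (by norm_num) (hN0 _))
              (mul_nonneg (mul_nonneg (by norm_num) hδ0) (mul_nonneg (by norm_num) (tau_nonneg _ _))))
              (Nat.cast_nonneg p)) (div_nonneg (hT0 _ _) (Nat.cast_nonneg p))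
  -- sum up
  calc ∑ l ∈ Finset.Ico 1 (D ^ 4), ‖nu χ l‖ / l *
        ∑ q ∈ l.divisorsAntidiagonal, ∑' m₁ : ℕ, ∑' p : ℕ,
          (if (D : ℝ) ^ 4 < q.2 * p ∧ p.Prime ∧ ¬ p ∣ q.1 ∧ 4 * (D : ℝ) ^ 4 * p ≤ bigT D ^ 2 then
            ‖bcoef D (q.1 * m₁)‖ * ‖nuOneStar c' χ (q.2 * p)‖ * ‖kappa2bar c' D (m₁ * p)‖ /
              ((m₁ : ℝ) * p) else 0)
      ≤ ∑ l ∈ Finset.Ico 1 (D ^ 4), ‖nu χ l‖ / l *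
          ∑ q ∈ l.divisorsAntidiagonal, (K * (tau 2 q.1 * ∑ p ∈ P₀, (2 * N q.2 + 2 * δ * (4 * tau 4 q.2)) / p) +
            K * (tau 2 q.1 * ∑ p ∈ P₀, T q.2 p / p)) := by
        refine Finset.sum_le_sum fun l hl => mul_le_mul_of_nonneg_left
          (Finset.sum_le_sum fun q hq' => hterm l hl q hq') (by positivity)
    _ = K * (∑ l ∈ Finset.Ico 1 (D ^ 4), ‖nu χ l‖ / l * ∑ q ∈ l.divisorsAntidiagonal,
            tau 2 q.1 * ∑ p ∈ P₀, (2 * N q.2 + 2 * δ * (4 * tau 4 q.2)) / p) +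
          K * (∑ l ∈ Finset.Ico 1 (D ^ 4), ‖nu χ l‖ / l * ∑ q ∈ l.divisorsAntidiagonal,
            tau 2 q.1 * ∑ p ∈ P₀, T q.2 p / p) := by
        rw [Finset.mul_sum, Finset.mul_sum, ← Finset.sum_add_distrib]
        refine Finset.sum_congr rfl fun l _ => ?_
        rw [Finset.sum_add_distrib, ← Finset.mul_sum, ← Finset.mul_sum]
        ring
    _ ≤ K * (∑ l ∈ Finset.Ico 1 (D ^ 4), ‖nu χ l‖ / l * ∑ q ∈ l.divisorsAntidiagonal,
            tau 2 q.1 * ∑ p ∈ P₀, (2 * N q.2 + 2 * δ * (4 * tau 4 q.2)) / p) +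
          K * (∑ l ∈ Finset.Ico 1 (D ^ 4), tau 2 l / l * ∑ q ∈ l.divisorsAntidiagonal,
            tau 2 q.1 * ∑ p ∈ P₀, T q.2 p / p) := by
        refine add_le_add le_rfl (mul_le_mul_of_nonneg_left (Finset.sum_le_sum fun l _ => ?_) hK0)
        refine mul_le_mul_of_nonneg_right (div_le_div_of_nonneg_right ?_ (Nat.cast_nonneg l))
          (Finset.sum_nonneg fun q _ => mul_nonneg (tau_nonneg _ _)
            (Finset.sum_nonneg fun p _ => div_nonneg (hT0 _ _) (Nat.cast_nonneg p)))
        rw [nu, tau_two_apply]; exact norm_divisorSumChar_le χ l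
    _ = _ := by rw [hK]; ring

end Literature.NumberTheory.LFunctions.Zhang2022.Phi3Eval
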